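import Mathlib
import Summits.ValiantsHypothesis.ValiantsHypothesis.Theorems.LacunarySymmetroidMatrixDescartesDefiniteMomentsBudgetRayleigh
import Summits.ValiantsHypothesis.ValiantsHypothesis.Theorems.LacunarySymmetroidMatrixDescartesDefiniteMomentsZonesNearby

/-!
# `MatrixDescartes` (stmt-ValiantsHypothesis-18050) — the DEFINITE-MOMENTS LAW, budget zones II: local structure and nearby
# counts under the abstract budget bundle

HONEST FRAMING.  Cell `pub-symmetroid`, seat `val-sym-mdr-p2` (gen 15); helper file `--supports` the crux
`Theses.LacunarySymmetroid.MatrixDescartes`, NO closure claim.  Verbatim re-run of `…ZonesLocal.locRoots` and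
`…ZonesNearby.count_stable_of_nonroot` / `count_near_root` with Descartes' budget `K − 1` replaced by an abstract budget `B ≥ 1`
(bundle of `…BudgetRayleigh`); nothing here bears on the crux in its window, on `stub_twoSided`, on `DoorA26`/`DoorA34`,
registers, or `VP ≠ VNP`. [folklore]; axioms standard; no definitions.
-/

-- layout Summits/ValiantsHypothesis/ValiantsHypothesis forces the duplicated namespace component
set_option linter.dupNamespace false

namespace Summit.ValiantsHypothesis.ValiantsHypothesis.Theorems.LacunarySymmetroidMatrixDescartes

open Polynomial Matrix Finset
open scoped BigOperators Topology

namespace DefiniteMoments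

section BudgetLocal

variable {ι : Type} [Fintype ι]

/-- **LOCAL STRUCTURE OF THE RAYLEIGH ROOTS under the budget bundle (`budget_locRoots`).**  Budget-sharp family (`B ≥ 1`); `v ≠ 0`; `r` the increasing
enumeration of the positive roots of `P_v`; `δ > 0` below every `rᵢ` and separating the windows `(rᵢ − δ, rᵢ + δ)`.  Then
for all `v'` near `v` the positive roots of `P_{v'}` are enumerated by some `z` with `zᵢ ∈ (rᵢ − δ, rᵢ + δ)`: ONE ROOT PER
WINDOW AND NONE ELSEWHERE.  (The sign of `vᵀF(·)v` flips across each window — simple roots, `eval_mul_eval_neg_of_simpleRoot`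
— and the flips survive a small perturbation of `v`; the intermediate value theorem puts a root of `P_{v'}` in each window,
and Descartes' budget `K − 1` leaves no other.) [folklore] -/
theorem budget_locRoots {K : ℕ} (d : Fin K → ℕ) (S : Fin K → Matrix ι ι ℝ) (B : ℕ) (hB1 : 1 ≤ B) (s : ℝ)
    (hB : ∀ u : ι → ℝ, ((∑ l, C (u ⬝ᵥ (S l *ᵥ u)) * (X : ℝ[X]) ^ d l).roots.filter (fun t => 0 < t)).card ≤ B)
    (hsh : ∀ u : ι → ℝ, u ≠ 0 →
      B ≤ ((∑ l, C (u ⬝ᵥ (S l *ᵥ u)) * (X : ℝ[X]) ^ d l).roots.toFinset.filter (fun t => 0 < t)).card)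
    (hs : ∀ u : ι → ℝ, u ≠ 0 → ∃ δ : ℝ, 0 < δ ∧ ∀ x : ℝ, 0 < x → x < δ →
      0 < s * (∑ l, C (u ⬝ᵥ (S l *ᵥ u)) * (X : ℝ[X]) ^ d l).eval x)
    (v : ι → ℝ) (hv : v ≠ 0) (r : Fin B → ℝ) (hr : StrictMono r)
    (hrT : ∀ x : ℝ, x ∈ ((∑ l, C (v ⬝ᵥ (S l *ᵥ v)) * (X : ℝ[X]) ^ d l).roots.toFinset.filter (fun t => 0 < t))
      ↔ ∃ i, r i = x)
    {δ : ℝ} (hδ : 0 < δ) (hδ0 : ∀ i, δ < r i) (hsep : ∀ i j : Fin B, i < j → r i + δ ≤ r j - δ) :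
    ∃ η : ℝ, 0 < η ∧ ∀ v' : ι → ℝ, dist v' v < η →
      ∃ z : Fin B → ℝ, (∀ i, r i - δ < z i ∧ z i < r i + δ) ∧
        ∀ x : ℝ, x ∈ ((∑ l, C (v' ⬝ᵥ (S l *ᵥ v')) * (X : ℝ[X]) ^ d l).roots.toFinset.filter (fun t => 0 < t))
          ↔ ∃ i, z i = x := by
  classical
  set Pv := ∑ l, C (v ⬝ᵥ (S l *ᵥ v)) * (X : ℝ[X]) ^ d l with hPv
  have hPv0 : Pv ≠ 0 := budget_ne_zero d S s hs v hv
  have hrmem : ∀ i, Pv.IsRoot (r i) ∧ 0 < r i := by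
    intro i
    have h := (hrT (r i)).2 ⟨i, rfl⟩
    rw [Finset.mem_filter, Multiset.mem_toFinset, mem_roots hPv0] at h
    exact h
  -- (a) the sign of `vᵀF(·)v` flips across each window
  have hflip : ∀ i, (v ⬝ᵥ ((∑ k, (r i - δ) ^ d k • S k) *ᵥ v)) * (v ⬝ᵥ ((∑ k, (r i + δ) ^ d k • S k) *ᵥ v)) < 0 := by
    intro i
    rw [← eval_rayleighPoly, ← eval_rayleighPoly]
    refine eval_mul_eval_neg_of_simpleRoot Pv hPv0 (by linarith) (by linarith) (hrmem i).1
      (rootMultiplicity_le_one_of_sharp Pv (budget_multiset d S B hB hsh v hv) (hrmem i).2) ?_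
    intro y hy1 hy2 hroot
    have hy0 : 0 < y := by linarith [hδ0 i]
    have hyT : y ∈ Pv.roots.toFinset.filter (fun t => 0 < t) := by
      rw [Finset.mem_filter, Multiset.mem_toFinset, mem_roots hPv0]; exact ⟨hroot, hy0⟩
    obtain ⟨j, rfl⟩ := (hrT y).1 hyT
    by_contra hne
    rcases lt_or_gt_of_ne hne with h | h
    · have := hsep j i (hr.lt_iff_lt.1 h); linarith
    · have := hsep i j (hr.lt_iff_lt.1 h); linarith
  -- (b) these finitely many strict signs survive near `v`
  have hev : ∀ᶠ v' in nhds v, ∀ i : Fin B,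
      0 < (v' ⬝ᵥ ((∑ k, (r i - δ) ^ d k • S k) *ᵥ v')) * (v ⬝ᵥ ((∑ k, (r i - δ) ^ d k • S k) *ᵥ v)) ∧
      0 < (v' ⬝ᵥ ((∑ k, (r i + δ) ^ d k • S k) *ᵥ v')) * (v ⬝ᵥ ((∑ k, (r i + δ) ^ d k • S k) *ᵥ v)) := by
    refine Filter.eventually_all.2 fun i => Filter.Eventually.and ?_ ?_
    · have hne : v ⬝ᵥ ((∑ k, (r i - δ) ^ d k • S k) *ᵥ v) ≠ 0 := fun h => by
        have := hflip i; rw [h, zero_mul] at this; exact lt_irrefl 0 this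
      have hc := ((continuous_quadForm (∑ k, (r i - δ) ^ d k • S k)).mul
        (continuous_const (y := v ⬝ᵥ ((∑ k, (r i - δ) ^ d k • S k) *ᵥ v)))).continuousAt (x := v)
      exact hc.eventually (lt_mem_nhds (mul_self_pos.2 hne))
    · have hne : v ⬝ᵥ ((∑ k, (r i + δ) ^ d k • S k) *ᵥ v) ≠ 0 := fun h => by
        have := hflip i; rw [h, mul_zero] at this; exact lt_irrefl 0 this
      have hc := ((continuous_quadForm (∑ k, (r i + δ) ^ d k • S k)).mul
        (continuous_const (y := v ⬝ᵥ ((∑ k, (r i + δ) ^ d k • S k) *ᵥ v)))).continuousAt (x := v)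
      exact hc.eventually (lt_mem_nhds (mul_self_pos.2 hne))
  obtain ⟨η, hη, hball⟩ := Metric.eventually_nhds_iff.1 hev
  refine ⟨η, hη, fun v' hv' => ?_⟩
  have hsg := hball hv'
  -- (c) one root of `P_{v'}` in each window
  have hneg : ∀ i, (v' ⬝ᵥ ((∑ k, (r i - δ) ^ d k • S k) *ᵥ v')) * (v' ⬝ᵥ ((∑ k, (r i + δ) ^ d k • S k) *ᵥ v')) < 0 := by
    intro i
    obtain ⟨h1, h2⟩ := hsg i
    have h3 := hflip i
    have h4 : 0 < ((v' ⬝ᵥ ((∑ k, (r i - δ) ^ d k • S k) *ᵥ v')) * (v' ⬝ᵥ ((∑ k, (r i + δ) ^ d k • S k) *ᵥ v')))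
        * ((v ⬝ᵥ ((∑ k, (r i - δ) ^ d k • S k) *ᵥ v)) * (v ⬝ᵥ ((∑ k, (r i + δ) ^ d k • S k) *ᵥ v))) := by
      have := mul_pos h1 h2; linarith [this]
    rcases mul_pos_iff.1 h4 with h | h
    · exact absurd h.2 (not_lt.2 h3.le)
    · exact h.1
  have hzex : ∀ i, ∃ zi : ℝ, r i - δ < zi ∧ zi < r i + δ ∧ v' ⬝ᵥ ((∑ k, zi ^ d k • S k) *ᵥ v') = 0 :=
    fun i => exists_zero_of_mul_neg (continuous_form d S v') (by linarith) (hneg i)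
  choose z hz1 hz2 hz3 using hzex
  -- (d) they are all the positive roots of `P_{v'}` (Descartes' budget)
  set Pw := ∑ l, C (v' ⬝ᵥ (S l *ᵥ v')) * (X : ℝ[X]) ^ d l with hPw
  have i₀ : Fin B := ⟨0, by omega⟩
  have hPw0 : Pw ≠ 0 := by
    refine rayleighPoly_ne_zero d S v' (x₀ := r i₀ + δ) fun h => ?_
    have := hneg i₀; rw [h, mul_zero] at this; exact lt_irrefl 0 this
  set T := Pw.roots.toFinset.filter (fun t => 0 < t) with hT
  have hzinj : Function.Injective z := injective_of_windows r z δ hsep fun i => ⟨hz1 i, hz2 i⟩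
  have hzsub : Finset.univ.image z ⊆ T := by
    intro x hx
    obtain ⟨i, -, rfl⟩ := Finset.mem_image.1 hx
    rw [hT, mem_posRoots_iff d S v' hPw0]
    exact ⟨by linarith [hz1 i, hδ0 i], hz3 i⟩
  have hcardT : T.card ≤ B := budget_card_le d S B hB v'
  have himg : Finset.univ.image z = T := by
    apply Finset.eq_of_subset_of_card_le hzsub
    rw [Finset.card_image_of_injective _ hzinj, Finset.card_univ, Fintype.card_fin]
    omega
  refine ⟨z, fun i => ⟨hz1 i, hz2 i⟩, fun x => ?_⟩
  rw [← himg, Finset.mem_image]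
  constructor
  · rintro ⟨i, -, hi⟩; exact ⟨i, hi⟩
  · rintro ⟨i, hi⟩; exact ⟨i, Finset.mem_univ _, hi⟩


/-- **Stable count at a non-root.**  Rayleigh-sharp pencil, `v ≠ 0`, `x > 0` with `vᵀF(x)v ≠ 0`: for all `v'` near `v`,
`N(x, v') = N(x, v)` and `v'ᵀF(x)v' ≠ 0`. [folklore] -/
theorem budget_count_stable_of_nonroot {K : ℕ} (d : Fin K → ℕ) (S : Fin K → Matrix ι ι ℝ) (B : ℕ) (hB1 : 1 ≤ B) (s : ℝ)
    (hB : ∀ u : ι → ℝ, ((∑ l, C (u ⬝ᵥ (S l *ᵥ u)) * (X : ℝ[X]) ^ d l).roots.filter (fun t => 0 < t)).card ≤ B)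
    (hsh : ∀ u : ι → ℝ, u ≠ 0 →
      B ≤ ((∑ l, C (u ⬝ᵥ (S l *ᵥ u)) * (X : ℝ[X]) ^ d l).roots.toFinset.filter (fun t => 0 < t)).card)
    (hs : ∀ u : ι → ℝ, u ≠ 0 → ∃ δ : ℝ, 0 < δ ∧ ∀ x : ℝ, 0 < x → x < δ →
      0 < s * (∑ l, C (u ⬝ᵥ (S l *ᵥ u)) * (X : ℝ[X]) ^ d l).eval x)
    (v : ι → ℝ) (hv : v ≠ 0) {x : ℝ} (hx : 0 < x) (hvx : v ⬝ᵥ ((∑ k, x ^ d k • S k) *ᵥ v) ≠ 0) :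
    ∃ η : ℝ, 0 < η ∧ ∀ v' : ι → ℝ, dist v' v < η →
      ((∑ l, C (v' ⬝ᵥ (S l *ᵥ v')) * (X : ℝ[X]) ^ d l).roots.toFinset.filter (fun t => 0 < t ∧ t < x)).card
        = ((∑ l, C (v ⬝ᵥ (S l *ᵥ v)) * (X : ℝ[X]) ^ d l).roots.toFinset.filter (fun t => 0 < t ∧ t < x)).card ∧
      v' ⬝ᵥ ((∑ k, x ^ d k • S k) *ᵥ v') ≠ 0 := by
  classical
  obtain ⟨r, hr, hrT⟩ := budget_enum d S B hB hsh v hv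
  have hPv0 := budget_ne_zero d S s hs v hv
  have hr0 : ∀ i, 0 < r i := fun i =>
    ((mem_posRoots_iff d S v hPv0 (r i)).1 ((hrT (r i)).2 ⟨i, rfl⟩)).1
  have hxr : ∀ i, r i ≠ x := by
    intro i h
    have hmem := (hrT (r i)).2 ⟨i, rfl⟩
    rw [h, mem_posRoots_iff d S v hPv0 x] at hmem
    exact hvx hmem.2
  set E : Finset ℝ := Finset.univ.image (fun i => |x - r i|) with hE
  have hEpos : ∀ e ∈ E, 0 < e := by
    intro e he
    obtain ⟨i, -, rfl⟩ := Finset.mem_image.1 he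
    exact abs_pos.2 (sub_ne_zero.2 (Ne.symm (hxr i)))
  obtain ⟨δ, hδ, hδ0, hsep, hδE⟩ := exists_window_radius r hr hr0 E hEpos
  have hfar : ∀ i, r i + δ ≤ x ∨ x ≤ r i - δ := by
    intro i
    have h := hδE (|x - r i|) (Finset.mem_image.2 ⟨i, Finset.mem_univ _, rfl⟩)
    rcases lt_or_gt_of_ne (hxr i) with hlt | hgt
    · left; rw [abs_of_pos (sub_pos.2 hlt)] at h; linarith
    · right; rw [abs_of_neg (sub_neg.2 hgt)] at h; linarith
  obtain ⟨η, hη, hloc⟩ := budget_locRoots d S B hB1 s hB hsh hs v hv r hr hrT hδ hδ0 hsep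
  refine ⟨η, hη, fun v' hv' => ?_⟩
  obtain ⟨z, hz, hzT⟩ := hloc v' hv'
  have hzinj := injective_of_windows r z δ hsep hz
  obtain ⟨hcount, hzx⟩ := count_eq_of_far r z δ hz x hfar
  refine ⟨?_, ?_⟩
  · rw [rootsBelow_enum d S v' z hzinj hzT x, hcount, rootsBelow_enum d S v r hr.injective hrT x]
  · intro h0
    have i₀ : Fin B := ⟨0, by omega⟩
    have hPw0 := ne_zero_of_mem_posRoots _ ((hzT (z i₀)).2 ⟨i₀, rfl⟩)
    obtain ⟨i, hi⟩ := (hzT x).1 ((mem_posRoots_iff d S v' hPw0 x).2 ⟨hx, h0⟩)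
    exact hzx i hi

/-- **Controlled count at a root.**  Rayleigh-sharp pencil, `v ≠ 0`, `x > 0` with `vᵀF(x)v = 0`: for all `v'` near `v`,
`N(x, v) ≤ N(x, v') ≤ N⁺(x, v') ≤ N(x, v) + 1`, and `N(x, v') = N(x, v)` if `v'ᵀF(x)v' = 0` as well. [folklore] -/
theorem budget_count_near_root {K : ℕ} (d : Fin K → ℕ) (S : Fin K → Matrix ι ι ℝ) (B : ℕ) (hB1 : 1 ≤ B) (s : ℝ)
    (hB : ∀ u : ι → ℝ, ((∑ l, C (u ⬝ᵥ (S l *ᵥ u)) * (X : ℝ[X]) ^ d l).roots.filter (fun t => 0 < t)).card ≤ B)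
    (hsh : ∀ u : ι → ℝ, u ≠ 0 →
      B ≤ ((∑ l, C (u ⬝ᵥ (S l *ᵥ u)) * (X : ℝ[X]) ^ d l).roots.toFinset.filter (fun t => 0 < t)).card)
    (hs : ∀ u : ι → ℝ, u ≠ 0 → ∃ δ : ℝ, 0 < δ ∧ ∀ x : ℝ, 0 < x → x < δ →
      0 < s * (∑ l, C (u ⬝ᵥ (S l *ᵥ u)) * (X : ℝ[X]) ^ d l).eval x)
    (v : ι → ℝ) (hv : v ≠ 0) {x : ℝ} (hx : 0 < x) (hvx : v ⬝ᵥ ((∑ k, x ^ d k • S k) *ᵥ v) = 0) :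
    ∃ η : ℝ, 0 < η ∧ ∀ v' : ι → ℝ, dist v' v < η →
      ((∑ l, C (v ⬝ᵥ (S l *ᵥ v)) * (X : ℝ[X]) ^ d l).roots.toFinset.filter (fun t => 0 < t ∧ t < x)).card
        ≤ ((∑ l, C (v' ⬝ᵥ (S l *ᵥ v')) * (X : ℝ[X]) ^ d l).roots.toFinset.filter (fun t => 0 < t ∧ t < x)).card ∧
      ((∑ l, C (v' ⬝ᵥ (S l *ᵥ v')) * (X : ℝ[X]) ^ d l).roots.toFinset.filter (fun t => 0 < t ∧ t ≤ x)).card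
        ≤ ((∑ l, C (v ⬝ᵥ (S l *ᵥ v)) * (X : ℝ[X]) ^ d l).roots.toFinset.filter (fun t => 0 < t ∧ t < x)).card + 1 ∧
      (v' ⬝ᵥ ((∑ k, x ^ d k • S k) *ᵥ v') = 0 →
        ((∑ l, C (v' ⬝ᵥ (S l *ᵥ v')) * (X : ℝ[X]) ^ d l).roots.toFinset.filter (fun t => 0 < t ∧ t < x)).card
          = ((∑ l, C (v ⬝ᵥ (S l *ᵥ v)) * (X : ℝ[X]) ^ d l).roots.toFinset.filter (fun t => 0 < t ∧ t < x)).card) := by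
  classical
  obtain ⟨r, hr, hrT⟩ := budget_enum d S B hB hsh v hv
  have hPv0 := budget_ne_zero d S s hs v hv
  have hr0 : ∀ i, 0 < r i := fun i =>
    ((mem_posRoots_iff d S v hPv0 (r i)).1 ((hrT (r i)).2 ⟨i, rfl⟩)).1
  obtain ⟨i₀, hi₀⟩ := (hrT x).1 ((mem_posRoots_iff d S v hPv0 x).2 ⟨hx, hvx⟩)
  obtain ⟨δ, hδ, hδ0, hsep, -⟩ := exists_window_radius r hr hr0 ∅ (fun e he => absurd he (Finset.notMem_empty e))
  obtain ⟨η, hη, hloc⟩ := budget_locRoots d S B hB1 s hB hsh hs v hv r hr hrT hδ hδ0 hsep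
  refine ⟨η, hη, fun v' hv' => ?_⟩
  obtain ⟨z, hz, hzT⟩ := hloc v' hv'
  have hzinj := injective_of_windows r z δ hsep hz
  rw [← hi₀, rootsBelow_enum d S v r hr.injective hrT (r i₀), rootsBelow_enum d S v' z hzinj hzT (r i₀),
    rootsUpTo_enum d S v' z hzinj hzT (r i₀)]
  refine ⟨count_at_root_lower r z hr δ hδ hsep hz i₀, count_at_root_upper r z hr δ hδ hsep hz i₀, fun h0 => ?_⟩
  have hPw0 := ne_zero_of_mem_posRoots _ ((hzT (z i₀)).2 ⟨i₀, rfl⟩)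
  have hmem := (hzT (r i₀)).1 ((mem_posRoots_iff d S v' hPw0 (r i₀)).2 ⟨hr0 i₀, h0⟩)
  exact count_at_common_root r z hr δ hδ hsep hz i₀ hmem


end BudgetLocal

end DefiniteMoments

end Summit.ValiantsHypothesis.ValiantsHypothesis.Theorems.LacunarySymmetroidMatrixDescartes
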